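import Mathlib

/-!
# `BalabanUV.Beta.KernelOrthoProjector` — binder row D1, JSB12SYM-SPINE v1.1 (Σ3) step K1-b core: THE ORTHOGONAL PROJECTOR ONTO THE KERNEL OF A
# FULL-ROW-RANK REAL MATRIX, `kerProj G := 1 − Gᵀ (G Gᵀ)⁻¹ G` — symmetric, idempotent, `G ∘ kerProj G = 0`, identity on `ker G`, and the Gram matrix
# `G Gᵀ` is invertible as soon as `G` has a right inverse (generic linear algebra for the block-orthogonal slice projector `symE` of the re-based literal)

HONEST FRAMING (cell contract, verbatim): «discharging `BetaPertH` makes Bałaban's UV stability UNCONDITIONAL — a real constructive-QFT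
result; it is NOT the continuum limit and NOT the Clay problem.»  THIS MODULE DISCHARGES NOTHING of `BetaPertH` ∕ row D1: [folklore] matrix algebra
over `ℝ` (Mathlib's `Matrix` API).  0 sorry, 0 `def … : Prop`, nothing cited; no object of Bałaban's is mentioned.

WHY (JSB12SYM-SPINE v1.1 (Σ3), RULING R-D1-g25-1): the symmetrised axial slice `S_sym = ker G_sym` of the re-based literal «JsB12Sym» is NOT a coordinate
subspace, so the comb spine's diagonal coordinate projector `axE`∕`axEc` has no analogue; the `RelInv` currency (`ChartConjugationRelative.RelInv`,
`RelInvCongruence.relInv_congr` needs `Eᵀ = E`) wants a SYMMETRIC idempotent with range `S_sym`.  Per block, `G_sym` (the symmetrised potential rows, S1)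
is a finite real matrix of FULL ROW RANK (it has the right inverse `(D!)⁻¹·grad∘(extension by zero at the root)`: `symAxial_grad`), and this file supplies
the projector and its four properties in that generality: `kerProj_transpose`, `kerProj_idem`, `mul_kerProj` (`G·P = 0`, i.e. range ⊆ ker G), `kerProj_mulVec_of_ker`
(identity on `ker G`), `kerProj_mulVec_eq_self_iff` (range = ker G exactly), and `isUnit_det_gram_of_mul_eq_one` (right inverse ⇒ `det (G Gᵀ) ≠ 0`, via
`Matrix.PosDef.mul_conjTranspose_self` + `PosDef.det_pos`).  The block packaging into an `MKer` (`symE`∕`symEc`) is K1-b proper (next file).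
NOT D1, NOT BetaPertH, NOT continuum, NOT Clay.
HONEST DEPENDENCY (verbatim): «continuum YM on T⁴ ⇐ BetaPertH ∧ nine spine estimates (0/9 proved); BetaPertH ⇐ (D1) ∧ (D4) ∧ CAP+tail;
G-an2-4 gates asym, D1 and NE2/3/4.»  ABSOLUTE RULE (cell, verbatim): «No internally-minted statement may enter as a cited fact. Every
hypothesis is either kernel-proved in this package or a verbatim quotation of a PUBLISHED theorem with page reference.»
Unit `b2b-balaban-beta-an2` gen 25 (row-D1 owner), 2026-08-21.
-/

namespace Summit.QuantumFields.BalabanUV.Beta.KernelOrthoProjector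

open Matrix

variable {m n : Type*} [Fintype m] [Fintype n] [DecidableEq m] [DecidableEq n]

/-- [our object] **THE KERNEL PROJECTOR** `P_G := 1 − Gᵀ (G Gᵀ)⁻¹ G` (Mathlib's `⁻¹` = adjugate ∕ det; the properties needing invertibility carry the
hypothesis `IsUnit (G Gᵀ).det`). -/
noncomputable def kerProj (G : Matrix m n ℝ) : Matrix n n ℝ := 1 - Gᵀ * (G * Gᵀ)⁻¹ * G

omit [Fintype m] [DecidableEq m] [DecidableEq n] in
/-- [folklore] The Gram matrix is symmetric. -/
theorem gram_transpose (G : Matrix m n ℝ) : (G * Gᵀ)ᵀ = G * Gᵀ := by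
  rw [transpose_mul, transpose_transpose]

/-- [folklore] **`P_G` IS SYMMETRIC.** -/
theorem kerProj_transpose (G : Matrix m n ℝ) : (kerProj G)ᵀ = kerProj G := by
  unfold kerProj
  rw [transpose_sub, transpose_one, transpose_mul, transpose_mul, transpose_transpose, transpose_nonsing_inv, gram_transpose,
    Matrix.mul_assoc]

/-- [folklore] **`P_G` IS THE IDENTITY ON `ker G`** (no rank hypothesis). -/
theorem kerProj_mulVec_of_ker (G : Matrix m n ℝ) {v : n → ℝ} (hv : G *ᵥ v = 0) : kerProj G *ᵥ v = v := by
  unfold kerProj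
  rw [sub_mulVec, one_mulVec, ← mulVec_mulVec, hv, mulVec_zero, sub_zero]

section FullRank

variable {G : Matrix m n ℝ}

/-- [folklore] **`G ∘ P_G = 0`** (full row rank): the range of `P_G` lies in `ker G`. -/
theorem mul_kerProj (hG : IsUnit (G * Gᵀ).det) : G * kerProj G = 0 := by
  unfold kerProj
  rw [Matrix.mul_sub, Matrix.mul_one, ← Matrix.mul_assoc, ← Matrix.mul_assoc, mul_nonsing_inv _ hG, Matrix.one_mul, sub_self]

/-- [folklore] `P_G ∘ Gᵀ = 0` (transpose of the previous). -/
theorem kerProj_mul_transpose (hG : IsUnit (G * Gᵀ).det) : kerProj G * Gᵀ = 0 := by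
  have h := congrArg transpose (mul_kerProj hG)
  rwa [transpose_mul, kerProj_transpose, transpose_zero] at h

/-- [folklore] **`P_G` IS IDEMPOTENT** (full row rank). -/
theorem kerProj_idem (hG : IsUnit (G * Gᵀ).det) : kerProj G * kerProj G = kerProj G := by
  have h : kerProj G * (Gᵀ * (G * Gᵀ)⁻¹ * G) = 0 := by
    rw [← Matrix.mul_assoc, ← Matrix.mul_assoc, kerProj_mul_transpose hG, Matrix.zero_mul, Matrix.zero_mul]
  have e : kerProj G * kerProj G = kerProj G * (1 - Gᵀ * (G * Gᵀ)⁻¹ * G) := rfl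
  rw [e, Matrix.mul_sub, Matrix.mul_one, h, sub_zero]

/-- [folklore] `G (P_G v) = 0` for every `v` (full row rank). -/
theorem mulVec_kerProj (hG : IsUnit (G * Gᵀ).det) (v : n → ℝ) : G *ᵥ (kerProj G *ᵥ v) = 0 := by
  rw [mulVec_mulVec, mul_kerProj hG, zero_mulVec]

/-- [folklore] **RANGE = KERNEL**: `P_G v = v ↔ G v = 0` (full row rank). -/
theorem kerProj_mulVec_eq_self_iff (hG : IsUnit (G * Gᵀ).det) (v : n → ℝ) : kerProj G *ᵥ v = v ↔ G *ᵥ v = 0 := by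
  constructor
  · intro h
    rw [← h]
    exact mulVec_kerProj hG v
  · exact kerProj_mulVec_of_ker G

/-- [folklore] `P_G (P_G v) = P_G v`. -/
theorem kerProj_mulVec_kerProj (hG : IsUnit (G * Gᵀ).det) (v : n → ℝ) : kerProj G *ᵥ (kerProj G *ᵥ v) = kerProj G *ᵥ v := by
  rw [mulVec_mulVec, kerProj_idem hG]

/-- [folklore] Symmetry in bilinear form: `u ⬝ (P_G v) = (P_G u) ⬝ v`. -/
theorem dotProduct_kerProj_mulVec (G : Matrix m n ℝ) (u v : n → ℝ) : u ⬝ᵥ (kerProj G *ᵥ v) = (kerProj G *ᵥ u) ⬝ᵥ v := by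
  rw [dotProduct_mulVec, ← vecMul_transpose, kerProj_transpose]

end FullRank

/-! ## Full row rank from a right inverse -/

omit [DecidableEq n] in
/-- [folklore] A right inverse makes `vecMul` injective (the rows of `G` are linearly independent). -/
theorem injective_vecMul_of_mul_eq_one {G : Matrix m n ℝ} {D : Matrix n m ℝ} (h : G * D = 1) : Function.Injective G.vecMul := by
  intro w w' hww
  have h' := congrArg (fun u => u ᵥ* D) hww
  simpa only [vecMul_vecMul, h, vecMul_one] using h'

omit [DecidableEq n] in
/-- [folklore] **THE GRAM MATRIX OF A FULL-ROW-RANK REAL MATRIX IS INVERTIBLE**: `Function.Injective G.vecMul → IsUnit (G Gᵀ).det`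
(`G Gᵀ` is positive definite, `Matrix.PosDef.mul_conjTranspose_self`). -/
theorem isUnit_det_gram_of_injective_vecMul {G : Matrix m n ℝ} (h : Function.Injective G.vecMul) : IsUnit (G * Gᵀ).det := by
  have hpd : (G * Gᵀ).PosDef := by
    have := Matrix.PosDef.mul_conjTranspose_self G h
    simpa only [conjTranspose_eq_transpose_of_trivial] using this
  exact isUnit_iff_ne_zero.mpr hpd.det_pos.ne'

omit [DecidableEq n] in
/-- [folklore] … in particular from a right inverse `G D = 1`. -/
theorem isUnit_det_gram_of_mul_eq_one {G : Matrix m n ℝ} {D : Matrix n m ℝ} (h : G * D = 1) : IsUnit (G * Gᵀ).det :=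
  isUnit_det_gram_of_injective_vecMul (injective_vecMul_of_mul_eq_one h)

end Summit.QuantumFields.BalabanUV.Beta.KernelOrthoProjector
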